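import Literature.Computability.Cryptography.VanDamSeroussiOracle2
import Literature.Computability.Cryptography.VanDamSeroussiOracleFP
import Literature.Computability.Complexity.CodeFPBudgets
import Literature.Computability.Complexity.CodeFPStringKit
import Literature.Computability.Complexity.HashBricks
import HarnessLib

/-!
# The oracle language of the van Dam–Seroussi circuit, IIb: the new kinds are polynomial time

Topic `Literature/Computability/Cryptography`; sequel of `VanDamSeroussiOracle2.lean` (the shift,
reconstruction and kick-back kinds `12–20`, `VDSOracle.newVal`) and `VanDamSeroussiOracleFP.lean`
(the code `Query.code`, `codeFP_fields`, `codeFP_valOfP`), for the discharge of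
`VanDamSeroussi2002_gaussSumPhase_qsolvable`: every new kind is a polynomial-time function of the
query, in the tree's `CodeFP` algebra (Arora–Barak 2009, §1.3):

* `codeFP_popcount`, `codeFP_cntL` (block counts are windows: `strDrop`, `strTake`, `popCountFn`);
  `codeFP_kapL` (the quadrant numerators); `codeFP_shL` — the applied power `Σ_j y_j 2^{⌊j/2B⌋}` as a
  CAPPED left fold over `range |y|` (`CodeFP.foldl`; the cap `|y|·2^{|y|}` never binds, `shL_eq_foldl`);
  `codeFP_refine` — Kitaev's integer refinement `OFPostCF.refineNat` as a capped fold of its step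
  (`refineNat_eq_foldl`, cap `8·2^{|y|}` by `OFPostCF.refineNat_lt`); `codeFP_uEstL`; `codeFP_addend`
  (`Complexity.ModArith.modExp` for `u^{p−2} mod p`); `codeFP_kOf`;
* **`codeFP_newVal`** and **`codeFP_valOfP₂`** (`q ↦ [tag ≠ DLOG] · valOf₂ q`, the arithmetic part of
  the post-processor of the sequel).

All proofs complete; no named fact.

## References

* S. Arora, B. Barak, *Computational Complexity: A Modern Approach*, CUP 2009, §1.3 [AroraBarak2009].
* A. Yu. Kitaev, arXiv:quant-ph/9511026 (1995), §3 Lemma 10, §5 [Kitaev1995].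
* W. van Dam, G. Seroussi, arXiv:quant-ph/0207131 (2002), §4 Algorithm 1 [VanDamSeroussi2002].
-/

noncomputable section

namespace Literature.Computability.Cryptography

namespace VDSOracle

open _root_.Computability Complexity Complexity.Brick Complexity.CodeFP Complexity.ModArith Polynomial Finset
open Hales2002 (kOf)
open OFPostCF (kq refineNat md kq_lt refineNat_lt)

/-! ### Windows and counts -/

/-- Counting the ones of a string is polynomial time. [cite: AroraBarak2009, §1.3] -/
theorem codeFP_popcount : CodeFP strE natE (fun w : List Bool => w.count true) :=
  ⟨HashBricks.popCountFn, HashBricks.popCountFn_mem_FP, fun w => by rw [HashBricks.popCountFn_apply]; rfl⟩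

/-- **Block counts are polynomial time** (input `(D, (B, y))`, unary offsets). [cite: AroraBarak2009, §1.3] -/
theorem codeFP_cntL : CodeFP (pairE unE (pairE unE strE)) natE (fun t => cntL t.2.2 t.1 t.2.1) := by
  have hdrop : CodeFP (pairE unE (pairE unE strE)) strE (fun t => t.2.2.drop t.1) := strDrop.comp ((fst _ _).pair (snd _ _).snd')
  have htake : CodeFP (pairE unE (pairE unE strE)) strE (fun t => (t.2.2.drop t.1).take t.2.1) := strTake.comp ((snd _ _).fst'.pair hdrop)
  exact (codeFP_popcount.comp htake).congr fun _ => rfl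

/-! ### The string context `(B, y)` and its unary bounds -/

/-- The context of the string kinds: block size (unary) and the register string. [folklore] -/
abbrev Ctx : Type := ℕ × List Bool

/-- The code of the context. [folklore] -/
abbrev ctxE : Ctx → List Bool := pairE unE strE

/-- `|y|` in unary. [folklore] -/
theorem codeFP_lenU : CodeFP ctxE unE (fun c : Ctx => c.2.length) := strLength.comp (snd _ _)

/-- `|y|` in binary. [folklore] -/
theorem codeFP_lenN : CodeFP ctxE natE (fun c : Ctx => c.2.length) := natOfUn.comp codeFP_lenU

/-- `B` in binary. [folklore] -/
theorem codeFP_BN : CodeFP ctxE natE (fun c : Ctx => c.1) := natOfUn.comp (fst _ _)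

/-- The number of levels `|y| / 2B`. [folklore] -/
theorem codeFP_lvL : CodeFP ctxE natE (fun c : Ctx => lvL c.1 c.2) :=
  (natDiv.comp (codeFP_lenN.pair (natMul.comp ((const _ 2).pair codeFP_BN)))).congr fun _ => rfl

/-- A binary quantity of the context, capped by `|y|`, in unary. [folklore] -/
theorem codeFP_capU {f : Ctx → ℕ} (hf : CodeFP ctxE natE f) : CodeFP ctxE unE (fun c : Ctx => min (f c) c.2.length) :=
  unOfNatMin.comp (codeFP_lenU.pair hf)

/-! ### The quadrant numerators -/

/-- `kq` of two bits as a binary numeral. [cite: Kitaev1995, §3 Lemma 10] -/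
theorem codeFP_kq : CodeFP (pairE bitE bitE) natE (fun t => kq t.1 t.2) := by
  refine ((fst bitE bitE).ite ((snd bitE bitE).ite (const _ 1) (const _ 7)) ((snd bitE bitE).ite (const _ 3) (const _ 5))).congr fun t => ?_
  obtain ⟨c, s⟩ := t
  cases c <;> cases s <;> rfl

/-- **The quadrant numerator of level `l`** (input `((B, y), l)`). [cite: Kitaev1995, §3 Lemma 10] -/
theorem codeFP_kapL : CodeFP (pairE ctxE natE) natE (fun t : Ctx × ℕ => kapL t.1.1 t.1.2 t.2) := by
  have hc : CodeFP (pairE ctxE natE) ctxE (fun t : Ctx × ℕ => t.1) := fst _ _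
  have hl : CodeFP (pairE ctxE natE) natE (fun t : Ctx × ℕ => t.2) := snd _ _
  have hB : CodeFP (pairE ctxE natE) natE (fun t : Ctx × ℕ => t.1.1) := codeFP_BN.comp hc
  have hBu : CodeFP (pairE ctxE natE) unE (fun t : Ctx × ℕ => t.1.1) := (fst _ _).comp hc
  have hy : CodeFP (pairE ctxE natE) strE (fun t : Ctx × ℕ => t.1.2) := (snd _ _).comp hc
  -- the two window offsets, capped by `|y|`, in unary
  have hD0n : CodeFP (pairE ctxE natE) natE (fun t : Ctx × ℕ => 2 * t.2 * t.1.1) :=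
    natMul.comp ((natMul.comp ((const _ 2).pair hl)).pair hB)
  have hD1n : CodeFP (pairE ctxE natE) natE (fun t : Ctx × ℕ => (2 * t.2 + 1) * t.1.1) :=
    natMul.comp ((natAdd.comp ((natMul.comp ((const _ 2).pair hl)).pair (const _ 1))).pair hB)
  have hD0 : CodeFP (pairE ctxE natE) unE (fun t : Ctx × ℕ => min (2 * t.2 * t.1.1) t.1.2.length) :=
    unOfNatMin.comp ((strLength.comp hy).pair hD0n)
  have hD1 : CodeFP (pairE ctxE natE) unE (fun t : Ctx × ℕ => min ((2 * t.2 + 1) * t.1.1) t.1.2.length) :=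
    unOfNatMin.comp ((strLength.comp hy).pair hD1n)
  have hc0 : CodeFP (pairE ctxE natE) natE (fun t : Ctx × ℕ => cntL t.1.2 (min (2 * t.2 * t.1.1) t.1.2.length) t.1.1) :=
    codeFP_cntL.comp (hD0.pair (hBu.pair hy))
  have hc1 : CodeFP (pairE ctxE natE) natE (fun t : Ctx × ℕ => cntL t.1.2 (min ((2 * t.2 + 1) * t.1.1) t.1.2.length) t.1.1) :=
    codeFP_cntL.comp (hD1.pair (hBu.pair hy))
  have hb0 : CodeFP (pairE ctxE natE) bitE (fun t : Ctx × ℕ => decide (2 * cntL t.1.2 (min (2 * t.2 * t.1.1) t.1.2.length) t.1.1 ≤ t.1.1)) :=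
    natLe.comp ((natMul.comp ((const _ 2).pair hc0)).pair hB)
  have hb1 : CodeFP (pairE ctxE natE) bitE (fun t : Ctx × ℕ => decide (2 * cntL t.1.2 (min ((2 * t.2 + 1) * t.1.1) t.1.2.length) t.1.1 ≤ t.1.1)) :=
    natLe.comp ((natMul.comp ((const _ 2).pair hc1)).pair hB)
  have hlv : CodeFP (pairE ctxE natE) bitE (fun t : Ctx × ℕ => decide (t.2 < lvL t.1.1 t.1.2)) := natLt.comp (hl.pair (codeFP_lvL.comp hc))
  refine (hlv.ite (codeFP_kq.comp (hb0.pair hb1)) (const _ 0)).congr fun t => ?_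
  obtain ⟨⟨B, y⟩, l⟩ := t
  dsimp only
  rw [kapL]
  by_cases h : l < lvL B y
  · -- inside the levels the caps do not bind
    have hlv' : l < y.length / (2 * B) := h
    have hB0 : 0 < B := by
      rcases Nat.eq_zero_or_pos B with hB | hB
      · rw [hB, mul_zero, Nat.div_zero] at hlv'; exact absurd hlv' (Nat.not_lt_zero _)
      · exact hB
    have hle : (2 * l + 1) * B + B ≤ y.length := by
      have h1 : l + 1 ≤ y.length / (2 * B) := hlv'
      have h2 := (Nat.le_div_iff_mul_le (by positivity)).1 h1
      nlinarith
    rw [decide_eq_true h, if_pos rfl, if_pos h, min_eq_left (by nlinarith), min_eq_left (by nlinarith)]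
  · rw [decide_eq_false h, if_neg Bool.false_ne_true, if_neg h]

/-! ### The applied power as a capped fold -/

/-- The term of control `j`: `y_j 2^{⌊j/2B⌋}`. [cite: Kitaev1995, §3 Lemma 10] -/
def shTerm (B : ℕ) (y : List Bool) (j : ℕ) : ℕ := (y.getD j false).toNat * 2 ^ (j / (2 * B))

/-- The cap of the fold computing `shL`: `|y| · 2^{|y|}`. [folklore] -/
def capS (y : List Bool) : ℕ := y.length * 2 ^ y.length

/-- **The capped step** of the fold computing `shL` (indices and exponents capped by `|y|`, the
accumulator by `capS`; on the actual run no cap binds). [cite: AroraBarak2009, §1.3] -/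
def shStep (c : Ctx) (j acc : ℕ) : ℕ :=
  min (acc + (c.2.getD (min j c.2.length) false).toNat * 2 ^ (min (j / (2 * c.1)) c.2.length)) (capS c.2)

/-- `shL` is the sum of the terms. [folklore] -/
theorem shL_eq_sum (B : ℕ) (y : List Bool) : shL B y = ∑ j ∈ range y.length, shTerm B y j := rfl

/-- A term is at most `2^{|y|}`. [folklore] -/
theorem shTerm_le {B : ℕ} {y : List Bool} {j : ℕ} (hj : j < y.length) : shTerm B y j ≤ 2 ^ y.length := by
  unfold shTerm
  have h1 : (y.getD j false).toNat ≤ 1 := by cases y.getD j false <;> simp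
  have h2 : 2 ^ (j / (2 * B)) ≤ 2 ^ y.length := Nat.pow_le_pow_right (by norm_num) ((Nat.div_le_self _ _).trans hj.le)
  calc (y.getD j false).toNat * 2 ^ (j / (2 * B)) ≤ 1 * 2 ^ y.length := Nat.mul_le_mul h1 h2
    _ = 2 ^ y.length := one_mul _

/-- Partial sums of the terms stay below the cap. [folklore] -/
theorem sum_shTerm_le (B : ℕ) (y : List Bool) {n : ℕ} (hn : n ≤ y.length) :
    ∑ j ∈ range n, shTerm B y j ≤ n * 2 ^ y.length := by
  calc ∑ j ∈ range n, shTerm B y j ≤ ∑ _j ∈ range n, 2 ^ y.length :=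
        sum_le_sum fun j hj => shTerm_le (lt_of_lt_of_le (mem_range.1 hj) hn)
    _ = n * 2 ^ y.length := by rw [sum_const, card_range, smul_eq_mul]

/-- **On the actual run the capped fold computes the partial sums.** [folklore] -/
theorem foldl_shStep (B : ℕ) (y : List Bool) : ∀ n, n ≤ y.length →
    (List.range n).foldl (fun acc j => shStep (B, y) j acc) 0 = ∑ j ∈ range n, shTerm B y j
  | 0, _ => by simp
  | n + 1, hn => by
    rw [List.range_succ, List.foldl_append, List.foldl_cons, List.foldl_nil, foldl_shStep B y n (by omega), sum_range_succ]
    have hjn : n < y.length := hn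
    unfold shStep
    dsimp only
    rw [min_eq_left hjn.le, min_eq_left ((Nat.div_le_self _ _).trans hjn.le)]
    refine min_eq_left ?_
    have := sum_shTerm_le B y hn
    rw [sum_range_succ] at this
    unfold capS
    unfold shTerm at this ⊢
    exact this.trans (Nat.mul_le_mul_right _ hn)

/-- **`shL` is the capped fold over `range |y|`.** [folklore] -/
theorem shL_eq_foldl (B : ℕ) (y : List Bool) : shL B y = (List.range y.length).foldl (fun acc j => shStep (B, y) j acc) 0 := by
  rw [foldl_shStep B y y.length le_rfl, shL_eq_sum]

/-- The capped fold never exceeds the cap. [folklore] -/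
theorem foldl_shStep_le (c : Ctx) : ∀ (l : List ℕ) (acc : ℕ), acc ≤ capS c.2 → l.foldl (fun acc j => shStep c j acc) acc ≤ capS c.2
  | [], _, h => h
  | _ :: l, _, _ => foldl_shStep_le c l _ (min_le_right _ _)

/-- The cap has size at most `2|y|`. [folklore] -/
theorem size_capS_le (y : List Bool) : Nat.size (capS y) ≤ 2 * y.length := by
  rw [Nat.size_le, capS, two_mul, pow_add]
  exact Nat.mul_lt_mul_of_lt_of_le (Nat.lt_two_pow_self) le_rfl (by positivity)

/-- The context code is at least as long as the string. [folklore] -/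
theorem length_le_length_ctxE (c : Ctx) : c.2.length ≤ (ctxE c).length := by
  obtain ⟨B, y⟩ := c
  show y.length ≤ (pairE unE strE (B, y)).length
  rw [pairE_apply, length_boolPair]
  change y.length ≤ 2 * (unE B).length + 2 + y.length
  omega

/-- The capped step is polynomial time. [cite: AroraBarak2009, §1.3] -/
theorem codeFP_shStep : CodeFP (pairE ctxE (pairE natE natE)) natE (fun t : Ctx × ℕ × ℕ => shStep t.1 t.2.1 t.2.2) := by
  have hc : CodeFP (pairE ctxE (pairE natE natE)) ctxE (fun t : Ctx × ℕ × ℕ => t.1) := fst _ _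
  have hj : CodeFP (pairE ctxE (pairE natE natE)) natE (fun t : Ctx × ℕ × ℕ => t.2.1) := (snd _ _).fst'
  have hacc : CodeFP (pairE ctxE (pairE natE natE)) natE (fun t : Ctx × ℕ × ℕ => t.2.2) := (snd _ _).snd'
  have hy : CodeFP (pairE ctxE (pairE natE natE)) strE (fun t : Ctx × ℕ × ℕ => t.1.2) := (snd _ _).comp hc
  have hlenU : CodeFP (pairE ctxE (pairE natE natE)) unE (fun t : Ctx × ℕ × ℕ => t.1.2.length) := codeFP_lenU.comp hc
  have hB : CodeFP (pairE ctxE (pairE natE natE)) natE (fun t : Ctx × ℕ × ℕ => t.1.1) := codeFP_BN.comp hc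
  have hjU : CodeFP (pairE ctxE (pairE natE natE)) unE (fun t : Ctx × ℕ × ℕ => min t.2.1 t.1.2.length) := unOfNatMin.comp (hlenU.pair hj)
  have hbit : CodeFP (pairE ctxE (pairE natE natE)) bitE (fun t : Ctx × ℕ × ℕ => t.1.2.getD (min t.2.1 t.1.2.length) false) :=
    strGetD.comp (hjU.pair hy)
  have hbn : CodeFP (pairE ctxE (pairE natE natE)) natE (fun t : Ctx × ℕ × ℕ => (t.1.2.getD (min t.2.1 t.1.2.length) false).toNat) :=
    (hbit.ite (const _ 1) (const _ 0)).congr fun t => by cases t.1.2.getD (min t.2.1 t.1.2.length) false <;> rfl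
  have he : CodeFP (pairE ctxE (pairE natE natE)) natE (fun t : Ctx × ℕ × ℕ => t.2.1 / (2 * t.1.1)) :=
    natDiv.comp (hj.pair (natMul.comp ((const _ 2).pair hB)))
  have heU : CodeFP (pairE ctxE (pairE natE natE)) unE (fun t : Ctx × ℕ × ℕ => min (t.2.1 / (2 * t.1.1)) t.1.2.length) :=
    unOfNatMin.comp (hlenU.pair he)
  have hpw : CodeFP (pairE ctxE (pairE natE natE)) natE (fun t : Ctx × ℕ × ℕ => 2 ^ min (t.2.1 / (2 * t.1.1)) t.1.2.length) :=
    natPow.comp ((const _ 2).pair heU)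
  have hcap : CodeFP (pairE ctxE (pairE natE natE)) natE (fun t : Ctx × ℕ × ℕ => capS t.1.2) :=
    (natMul.comp ((natOfUn.comp hlenU).pair (natPow.comp ((const _ 2).pair hlenU)))).congr fun _ => rfl
  exact (natMin.comp ((natAdd.comp (hacc.pair (natMul.comp (hbn.pair hpw)))).pair hcap)).congr fun _ => rfl

/-- **The applied power `shL` is polynomial time.** [cite: AroraBarak2009, §1.3] [cite: Kitaev1995, §3 Lemma 10] -/
theorem codeFP_shL : CodeFP ctxE natE (fun c : Ctx => shL c.1 c.2) := by
  have hfold := CodeFP.foldl (eσ := ctxE) (eα := natE) (eβ := natE) (step := shStep) (init := fun _ => 0)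
    codeFP_shStep (const _ 0) (2 * X) (fun c l₁ l₂ => by
      rw [eval_mul, eval_ofNat, eval_X]
      have h1 : (natE (l₁.foldl (fun b a => shStep c a b) 0)).length ≤ 2 * c.2.length := by
        rw [CodeFP.length_natE]
        exact (size_mono (foldl_shStep_le c l₁ 0 (Nat.zero_le _))).trans (size_capS_le c.2)
      have h2 : c.2.length ≤ (pairE ctxE (rawE natE) (c, l₁ ++ l₂)).length := by
        rw [pairE_apply, length_boolPair]
        have := length_le_length_ctxE c
        dsimp only
        omega
      omega)
  have h := hfold.comp ((CodeFP.id ctxE).pair (urange.comp codeFP_lenU))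
  refine h.congr fun c => ?_
  obtain ⟨B, y⟩ := c
  dsimp only
  exact (shL_eq_foldl B y).symm

/-! ### Kitaev's integer refinement as a capped fold -/

/-- The cap of the refinement fold: `8 · 2^{|y|}`. [folklore] -/
def capR (y : List Bool) : ℕ := 8 * 2 ^ y.length

/-- **Kitaev's refinement step at depth `d₁`** for the numerators `kapL`. [cite: Kitaev1995, §3 Lemma 10] -/
def rStepRaw (c : Ctx) (d1 a : ℕ) : ℕ :=
  if md ((a + 8 * 2 ^ d1 - kapL c.1 c.2 (lvL c.1 c.2 - 1 - d1) * 2 ^ d1) % (8 * 2 ^ d1)) (8 * 2 ^ d1) ≤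
      md ((a + 8 * 2 ^ d1 / 2 + 8 * 2 ^ d1 - kapL c.1 c.2 (lvL c.1 c.2 - 1 - d1) * 2 ^ d1) % (8 * 2 ^ d1)) (8 * 2 ^ d1)
  then a else a + 8 * 2 ^ d1 / 2

/-- The recursion of `refineNat` is the step. [cite: Kitaev1995, §3 Lemma 10] -/
theorem refineNat_succ_eq (c : Ctx) (d : ℕ) :
    refineNat (kapL c.1 c.2) (lvL c.1 c.2) (d + 1) = rStepRaw c (d + 1) (refineNat (kapL c.1 c.2) (lvL c.1 c.2) d) := by
  rw [refineNat, rStepRaw]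

/-- **The capped step** (depth capped by `|y|`, value by `capR`). [cite: AroraBarak2009, §1.3] -/
def rStep (c : Ctx) (d' a : ℕ) : ℕ := min (rStepRaw c (min (d' + 1) c.2.length) a) (capR c.2)

/-- The numerators are `< 8`. [folklore] -/
theorem kapL_lt (B : ℕ) (y : List Bool) (l : ℕ) : kapL B y l < 8 := by
  unfold kapL; split_ifs
  · exact kq_lt _ _
  · norm_num

/-- There are at most `|y|` levels. [folklore] -/
theorem lvL_le (B : ℕ) (y : List Bool) : lvL B y ≤ y.length := Nat.div_le_self _ _

/-- **On the actual run the capped fold is the refinement.** [folklore] -/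
theorem foldl_rStep (c : Ctx) : ∀ d, d + 1 ≤ lvL c.1 c.2 →
    (List.range d).foldl (fun a d' => rStep c d' a) (kapL c.1 c.2 (lvL c.1 c.2 - 1)) = refineNat (kapL c.1 c.2) (lvL c.1 c.2) d
  | 0, _ => by rw [List.range_zero, List.foldl_nil, refineNat]
  | d + 1, hd => by
    rw [List.range_succ, List.foldl_append, List.foldl_cons, List.foldl_nil, foldl_rStep c d (by omega), refineNat_succ_eq]
    unfold rStep
    have hd1 : d + 1 ≤ c.2.length := by have := lvL_le c.1 c.2; omega
    rw [min_eq_left hd1]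
    refine min_eq_left ?_
    rw [← refineNat_succ_eq]
    have hlt := refineNat_lt (kapL_lt c.1 c.2) (lvL c.1 c.2) (d + 1)
    unfold capR
    exact hlt.le.trans (Nat.mul_le_mul_left 8 (Nat.pow_le_pow_right (by norm_num) hd1))

/-- **The refinement is the capped fold over `range (Lv − 1)`.** [folklore] -/
theorem refine_eq_foldl (c : Ctx) :
    refineNat (kapL c.1 c.2) (lvL c.1 c.2) (lvL c.1 c.2 - 1) =
      (List.range (lvL c.1 c.2 - 1)).foldl (fun a d' => rStep c d' a) (kapL c.1 c.2 (lvL c.1 c.2 - 1)) := by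
  rcases Nat.eq_zero_or_pos (lvL c.1 c.2) with h | h
  · rw [h, Nat.zero_sub, List.range_zero, List.foldl_nil, refineNat]
  · exact (foldl_rStep c (lvL c.1 c.2 - 1) (by omega)).symm

/-- The capped fold never exceeds the cap. [folklore] -/
theorem foldl_rStep_le (c : Ctx) : ∀ (l : List ℕ) (a : ℕ), a ≤ capR c.2 → l.foldl (fun a d' => rStep c d' a) a ≤ capR c.2
  | [], _, h => h
  | _ :: l, _, _ => foldl_rStep_le c l _ (min_le_right _ _)

/-- The initial numerator is below the cap. [folklore] -/
theorem kapL_le_capR (c : Ctx) (l : ℕ) : kapL c.1 c.2 l ≤ capR c.2 := by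
  have := kapL_lt c.1 c.2 l
  unfold capR
  have : 1 ≤ 2 ^ c.2.length := Nat.one_le_two_pow
  nlinarith

/-- The cap has size at most `|y| + 4`. [folklore] -/
theorem size_capR_le (y : List Bool) : Nat.size (capR y) ≤ y.length + 4 := by
  rw [Nat.size_le, capR, pow_add]
  have : 0 < 2 ^ y.length := by positivity
  nlinarith

/-- The capped step is polynomial time. [cite: AroraBarak2009, §1.3] -/
theorem codeFP_rStep : CodeFP (pairE ctxE (pairE natE natE)) natE (fun t : Ctx × ℕ × ℕ => rStep t.1 t.2.1 t.2.2) := by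
  have hc : CodeFP (pairE ctxE (pairE natE natE)) ctxE (fun t : Ctx × ℕ × ℕ => t.1) := fst _ _
  have hd : CodeFP (pairE ctxE (pairE natE natE)) natE (fun t : Ctx × ℕ × ℕ => t.2.1) := (snd _ _).fst'
  have ha : CodeFP (pairE ctxE (pairE natE natE)) natE (fun t : Ctx × ℕ × ℕ => t.2.2) := (snd _ _).snd'
  have hlenU : CodeFP (pairE ctxE (pairE natE natE)) unE (fun t : Ctx × ℕ × ℕ => t.1.2.length) := codeFP_lenU.comp hc
  have heU : CodeFP (pairE ctxE (pairE natE natE)) unE (fun t : Ctx × ℕ × ℕ => min (t.2.1 + 1) t.1.2.length) :=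
    unOfNatMin.comp (hlenU.pair (natAdd.comp (hd.pair (const _ 1))))
  have heN : CodeFP (pairE ctxE (pairE natE natE)) natE (fun t : Ctx × ℕ × ℕ => min (t.2.1 + 1) t.1.2.length) := natOfUn.comp heU
  have hP : CodeFP (pairE ctxE (pairE natE natE)) natE (fun t : Ctx × ℕ × ℕ => 2 ^ min (t.2.1 + 1) t.1.2.length) :=
    natPow.comp ((const _ 2).pair heU)
  have hN : CodeFP (pairE ctxE (pairE natE natE)) natE (fun t : Ctx × ℕ × ℕ => 8 * 2 ^ min (t.2.1 + 1) t.1.2.length) :=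
    natMul.comp ((const _ 8).pair hP)
  have hH : CodeFP (pairE ctxE (pairE natE natE)) natE (fun t : Ctx × ℕ × ℕ => 8 * 2 ^ min (t.2.1 + 1) t.1.2.length / 2) :=
    natDiv.comp (hN.pair (const _ 2))
  have hidx : CodeFP (pairE ctxE (pairE natE natE)) natE (fun t : Ctx × ℕ × ℕ => lvL t.1.1 t.1.2 - 1 - min (t.2.1 + 1) t.1.2.length) :=
    natSub.comp ((natSub.comp ((codeFP_lvL.comp hc).pair (const _ 1))).pair heN)
  have hk : CodeFP (pairE ctxE (pairE natE natE)) natE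
      (fun t : Ctx × ℕ × ℕ => kapL t.1.1 t.1.2 (lvL t.1.1 t.1.2 - 1 - min (t.2.1 + 1) t.1.2.length)) :=
    codeFP_kapL.comp (hc.pair hidx)
  have hv : CodeFP (pairE ctxE (pairE natE natE)) natE
      (fun t : Ctx × ℕ × ℕ => kapL t.1.1 t.1.2 (lvL t.1.1 t.1.2 - 1 - min (t.2.1 + 1) t.1.2.length) * 2 ^ min (t.2.1 + 1) t.1.2.length) :=
    natMul.comp (hk.pair hP)
  have hx1 : CodeFP (pairE ctxE (pairE natE natE)) natE (fun t : Ctx × ℕ × ℕ =>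
      (t.2.2 + 8 * 2 ^ min (t.2.1 + 1) t.1.2.length -
        kapL t.1.1 t.1.2 (lvL t.1.1 t.1.2 - 1 - min (t.2.1 + 1) t.1.2.length) * 2 ^ min (t.2.1 + 1) t.1.2.length) %
        (8 * 2 ^ min (t.2.1 + 1) t.1.2.length)) :=
    natMod.comp ((natSub.comp ((natAdd.comp (ha.pair hN)).pair hv)).pair hN)
  have hx2 : CodeFP (pairE ctxE (pairE natE natE)) natE (fun t : Ctx × ℕ × ℕ =>
      (t.2.2 + 8 * 2 ^ min (t.2.1 + 1) t.1.2.length / 2 + 8 * 2 ^ min (t.2.1 + 1) t.1.2.length -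
        kapL t.1.1 t.1.2 (lvL t.1.1 t.1.2 - 1 - min (t.2.1 + 1) t.1.2.length) * 2 ^ min (t.2.1 + 1) t.1.2.length) %
        (8 * 2 ^ min (t.2.1 + 1) t.1.2.length)) :=
    natMod.comp ((natSub.comp ((natAdd.comp ((natAdd.comp (ha.pair hH)).pair hN)).pair hv)).pair hN)
  have hmd : ∀ {f : Ctx × ℕ × ℕ → ℕ}, CodeFP (pairE ctxE (pairE natE natE)) natE f →
      CodeFP (pairE ctxE (pairE natE natE)) natE (fun t => md (f t) (8 * 2 ^ min (t.2.1 + 1) t.1.2.length)) :=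
    fun hf => (natMin.comp (hf.pair (natSub.comp (hN.pair hf)))).congr fun _ => rfl
  have hcond := natLe.comp ((hmd hx1).pair (hmd hx2))
  have hraw := hcond.ite ha (natAdd.comp (ha.pair hH))
  have hcap : CodeFP (pairE ctxE (pairE natE natE)) natE (fun t : Ctx × ℕ × ℕ => capR t.1.2) :=
    (natMul.comp ((const _ 8).pair (natPow.comp ((const _ 2).pair hlenU)))).congr fun _ => rfl
  refine (natMin.comp (hraw.pair hcap)).congr fun t => ?_
  dsimp only
  rw [rStep, rStepRaw]
  split_ifs with h1 h2 h2
  · rfl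
  · exact absurd (of_decide_eq_true h1) h2
  · exact absurd (decide_eq_true h2) h1
  · rfl

/-- **Kitaev's integer refinement (with the numerators `kapL`) is polynomial time.** [cite: AroraBarak2009, §1.3] [cite: Kitaev1995, §3 Lemma 10] -/
theorem codeFP_refine : CodeFP ctxE natE (fun c : Ctx => refineNat (kapL c.1 c.2) (lvL c.1 c.2) (lvL c.1 c.2 - 1)) := by
  have hinit : CodeFP ctxE natE (fun c : Ctx => kapL c.1 c.2 (lvL c.1 c.2 - 1)) :=
    codeFP_kapL.comp ((CodeFP.id ctxE).pair (natSub.comp (codeFP_lvL.pair (const _ 1))))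
  have hfold := CodeFP.foldl (eσ := ctxE) (eα := natE) (eβ := natE) (step := rStep) (init := fun c : Ctx => kapL c.1 c.2 (lvL c.1 c.2 - 1))
    codeFP_rStep hinit (X + 4) (fun c l₁ l₂ => by
      rw [eval_add, eval_X, eval_ofNat]
      have h1 : (natE (l₁.foldl (fun b a => rStep c a b) (kapL c.1 c.2 (lvL c.1 c.2 - 1)))).length ≤ c.2.length + 4 := by
        rw [CodeFP.length_natE]
        exact (size_mono (foldl_rStep_le c l₁ _ (kapL_le_capR c _))).trans (size_capR_le c.2)
      have h2 : c.2.length ≤ (pairE ctxE (rawE natE) (c, l₁ ++ l₂)).length := by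
        rw [pairE_apply, length_boolPair]
        have := length_le_length_ctxE c
        dsimp only
        omega
      omega)
  have hlist : CodeFP ctxE (rawE natE) (fun c : Ctx => List.range (min (lvL c.1 c.2 - 1) c.2.length)) :=
    urange.comp (codeFP_capU (natSub.comp (codeFP_lvL.pair (const _ 1))))
  have h := hfold.comp ((CodeFP.id ctxE).pair hlist)
  refine h.congr fun c => ?_
  show List.foldl (fun b a => rStep c a b) (kapL c.1 c.2 (lvL c.1 c.2 - 1)) (List.range (min (lvL c.1 c.2 - 1) c.2.length)) = _
  rw [min_eq_left (by have := lvL_le c.1 c.2; omega), ← refine_eq_foldl]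

/-- **The mode index `uEstL` is polynomial time** (input `((B, y), M)`). [cite: AroraBarak2009, §1.3] [cite: Kitaev1995, §5] -/
theorem codeFP_uEstL : CodeFP (pairE ctxE natE) natE (fun t : Ctx × ℕ => uEstL t.1.1 t.2 t.1.2) := by
  have hc : CodeFP (pairE ctxE natE) ctxE (fun t : Ctx × ℕ => t.1) := fst _ _
  have hM : CodeFP (pairE ctxE natE) natE (fun t : Ctx × ℕ => t.2) := snd _ _
  have hA : CodeFP (pairE ctxE natE) natE (fun t : Ctx × ℕ => refineNat (kapL t.1.1 t.1.2) (lvL t.1.1 t.1.2) (lvL t.1.1 t.1.2 - 1)) :=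
    codeFP_refine.comp hc
  have heU : CodeFP (pairE ctxE natE) unE (fun t : Ctx × ℕ => min (lvL t.1.1 t.1.2 - 1) t.1.2.length) :=
    (codeFP_capU (natSub.comp (codeFP_lvL.pair (const _ 1)))).comp hc
  have hD : CodeFP (pairE ctxE natE) natE (fun t : Ctx × ℕ => 8 * 2 ^ min (lvL t.1.1 t.1.2 - 1) t.1.2.length) :=
    natMul.comp ((const _ 8).pair (natPow.comp ((const _ 2).pair heU)))
  have hnum : CodeFP (pairE ctxE natE) natE (fun t : Ctx × ℕ =>
      2 * t.2 * refineNat (kapL t.1.1 t.1.2) (lvL t.1.1 t.1.2) (lvL t.1.1 t.1.2 - 1) + 8 * 2 ^ min (lvL t.1.1 t.1.2 - 1) t.1.2.length) :=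
    natAdd.comp ((natMul.comp ((natMul.comp ((const _ 2).pair hM)).pair hA)).pair hD)
  refine ((natMod.comp ((natDiv.comp (hnum.pair (natMul.comp ((const _ 2).pair hD)))).pair hM)).congr fun t => ?_)
  dsimp only
  rw [uEstL, min_eq_left (by have := lvL_le t.1.1 t.1.2; omega)]

/-! ### The kick-back addend and Hales's division -/

/-- `addend` vanishes for `p < 2`. [folklore] -/
theorem addend_of_lt_two {p : ℕ} (hp : p < 2) (a : ℕ) (s : Bool) (d u : ℕ) : addend p a s d u = 0 := by
  unfold addend
  interval_cases p
  · simp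
  · simp [Nat.mod_one]

/-- **The kick-back addend is polynomial time** (input `(p, a, s, d, u)`; the power `u^{p−2} mod p` by
repeated squaring, `Complexity.ModArith.modExp`). [cite: AroraBarak2009, §1.3] -/
theorem codeFP_addend : CodeFP (pairE natE (pairE natE (pairE bitE (pairE natE natE)))) natE
    (fun t : ℕ × ℕ × Bool × ℕ × ℕ => addend t.1 t.2.1 t.2.2.1 t.2.2.2.1 t.2.2.2.2) := by
  have hp : CodeFP (pairE natE (pairE natE (pairE bitE (pairE natE natE)))) natE (fun t : ℕ × ℕ × Bool × ℕ × ℕ => t.1) := fst _ _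
  have ha : CodeFP (pairE natE (pairE natE (pairE bitE (pairE natE natE)))) natE (fun t : ℕ × ℕ × Bool × ℕ × ℕ => t.2.1) := (snd _ _).fst'
  have hs : CodeFP (pairE natE (pairE natE (pairE bitE (pairE natE natE)))) bitE (fun t : ℕ × ℕ × Bool × ℕ × ℕ => t.2.2.1) := (snd _ _).snd'.fst'
  have hd : CodeFP (pairE natE (pairE natE (pairE bitE (pairE natE natE)))) natE (fun t : ℕ × ℕ × Bool × ℕ × ℕ => t.2.2.2.1) :=
    (snd _ _).snd'.snd'.fst'
  have hu : CodeFP (pairE natE (pairE natE (pairE bitE (pairE natE natE)))) natE (fun t : ℕ × ℕ × Bool × ℕ × ℕ => t.2.2.2.2) :=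
    (snd _ _).snd'.snd'.snd'
  have hp1 : CodeFP (pairE natE (pairE natE (pairE bitE (pairE natE natE)))) natE (fun t : ℕ × ℕ × Bool × ℕ × ℕ => t.1 - 1) :=
    natSub.comp (hp.pair (const _ 1))
  have he : CodeFP (pairE natE (pairE natE (pairE bitE (pairE natE natE)))) natE (fun t : ℕ × ℕ × Bool × ℕ × ℕ => expOf t.1 t.2.1 t.2.2.1) :=
    (hs.ite (natDiv.comp (hp1.pair (const _ 2))) ha).congr fun t => by unfold expOf; cases t.2.2.1 <;> rfl
  have hm : CodeFP (pairE natE (pairE natE (pairE bitE (pairE natE natE)))) natE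
      (fun t : ℕ × ℕ × Bool × ℕ × ℕ => expOf t.1 t.2.1 t.2.2.1 * t.2.2.2.1 % (t.1 - 1)) := natMod.comp ((natMul.comp (he.pair hd)).pair hp1)
  have hr : CodeFP (pairE natE (pairE natE (pairE bitE (pairE natE natE)))) natE
      (fun t : ℕ × ℕ × Bool × ℕ × ℕ => (2 * t.1 * (expOf t.1 t.2.1 t.2.2.1 * t.2.2.2.1 % (t.1 - 1)) + (t.1 - 1)) / (2 * (t.1 - 1))) :=
    natDiv.comp ((natAdd.comp ((natMul.comp ((natMul.comp ((const _ 2).pair hp)).pair hm)).pair hp1)).pair (natMul.comp ((const _ 2).pair hp1)))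
  have hpow : CodeFP (pairE natE (pairE natE (pairE bitE (pairE natE natE)))) natE (fun t : ℕ × ℕ × Bool × ℕ × ℕ => powM t.1 t.2.2.2.2 (t.1 - 2)) :=
    modExp.comp (hu.pair ((natSub.comp (hp.pair (const _ 2))).pair hp))
  have hval : CodeFP (pairE natE (pairE natE (pairE bitE (pairE natE natE)))) natE (fun t : ℕ × ℕ × Bool × ℕ × ℕ =>
      (2 * t.1 * (expOf t.1 t.2.1 t.2.2.1 * t.2.2.2.1 % (t.1 - 1)) + (t.1 - 1)) / (2 * (t.1 - 1)) * powM t.1 t.2.2.2.2 (t.1 - 2) % t.1) :=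
    natMod.comp ((natMul.comp (hr.pair hpow)).pair hp)
  have hz : CodeFP (pairE natE (pairE natE (pairE bitE (pairE natE natE)))) bitE (fun t : ℕ × ℕ × Bool × ℕ × ℕ => decide (t.2.2.2.2 % t.1 = 0)) :=
    (eq natE_injective).comp ((natMod.comp (hu.pair hp)).pair (const _ 0))
  have h2 : CodeFP (pairE natE (pairE natE (pairE bitE (pairE natE natE)))) bitE (fun t : ℕ × ℕ × Bool × ℕ × ℕ => decide (2 ≤ t.1)) :=
    natLe.comp ((const _ 2).pair hp)
  refine (h2.ite (hz.ite (const _ 0) hval) (const _ 0)).congr fun t => ?_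
  obtain ⟨p, a, s, d, u⟩ := t
  dsimp only
  by_cases hp2 : 2 ≤ p
  · rw [decide_eq_true hp2, if_pos rfl, addend]
    by_cases hz0 : u % p = 0
    · rw [decide_eq_true hz0, if_pos rfl, if_pos hz0]
    · rw [decide_eq_false hz0, if_neg Bool.false_ne_true, if_neg hz0, powM, if_pos hp2, Nat.mul_mod, Nat.mod_mod, ← Nat.mul_mod]
  · rw [decide_eq_false hp2, if_neg Bool.false_ne_true, addend_of_lt_two (not_le.1 hp2)]

/-- **Hales's division `kOf`** of three polynomial-time quantities. [cite: Hales2002, Ch. 9 §2 Def. 25] -/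
theorem codeFP_kOf {α : Type} {eα : α → List Bool} {P Q Z : α → ℕ} (hP : CodeFP eα natE P) (hQ : CodeFP eα natE Q) (hZ : CodeFP eα natE Z) :
    CodeFP eα natE (fun x => kOf (P x) (Q x) (Z x)) := by
  have h2z : CodeFP eα natE (fun x => 2 * Z x * P x + Q x) := natAdd.comp ((natMul.comp ((natMul.comp ((const _ 2).pair hZ)).pair hP)).pair hQ)
  have h2Q : CodeFP eα natE (fun x => 2 * Q x) := natMul.comp ((const _ 2).pair hQ)
  exact (natMod.comp ((natDiv.comp (h2z.pair h2Q)).pair hP)).congr fun _ => rfl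

/-! ### The new kinds -/

/-- The string context `(L, r₁)` of a query. [folklore] -/
theorem codeFP_qctx : CodeFP Query.code ctxE (fun q => (q.L, q.r1)) := by
  obtain ⟨-, -, -, -, -, -, hL, -, -⟩ := codeFP_fields
  exact hL.pair codeFP_regs.1

/-- `shL L r₁` of a query. [cite: AroraBarak2009, §1.3] -/
theorem codeFP_qshL : CodeFP Query.code natE (fun q => shL q.L q.r1) := by
  have h := codeFP_shL.comp codeFP_qctx
  exact h.congr fun _ => rfl

/-- `2^{|r₂|}` of a query. [folklore] -/
theorem codeFP_qQ : CodeFP Query.code natE (fun q => 2 ^ q.r2.length) := natPow.comp ((const _ 2).pair (strLength.comp codeFP_regs.2))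

/-- `uEstL L M r₁` of a query, for a polynomial-time modulus. [cite: AroraBarak2009, §1.3] -/
theorem codeFP_quEstL {M : Query → ℕ} (hM : CodeFP Query.code natE M) : CodeFP Query.code natE (fun q => uEstL q.L (M q) q.r1) := by
  have hargs : CodeFP Query.code (pairE ctxE natE) (fun q => ((q.L, q.r1), M q)) := codeFP_qctx.pair hM
  have h := codeFP_uEstL.comp hargs
  exact h.congr fun _ => rfl

/-- The branch bit `head r₁`. [folklore] -/
theorem codeFP_qhead : CodeFP Query.code bitE (fun q => q.r1.headD false) := by
  have h := strGetD.comp ((const _ 0).pair codeFP_regs.1)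
  exact h.congr fun q => by show q.r1.getD 0 false = q.r1.headD false; cases q.r1 <;> rfl

/-- The discrete logarithm field `val (tail r₁)`. [folklore] -/
theorem codeFP_qtail : CodeFP Query.code natE (fun q => bitsToNat q.r1.tail) := by
  have h := strVal.comp (strDrop.comp ((const _ 1).pair codeFP_regs.1))
  exact h.congr fun q => by show bitsToNat (q.r1.drop 1) = bitsToNat q.r1.tail; cases q.r1 <;> rfl

/-- The addend of a query. [cite: AroraBarak2009, §1.3] -/
theorem codeFP_qaddend : CodeFP Query.code natE (fun q => addend q.p q.a (q.r1.headD false) (bitsToNat q.r1.tail) (bitsToNat q.r2)) := by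
  obtain ⟨hp, -, ha, -⟩ := codeFP_fields
  have hargs : CodeFP Query.code (pairE natE (pairE natE (pairE bitE (pairE natE natE))))
      (fun q => (q.p, q.a, q.r1.headD false, bitsToNat q.r1.tail, bitsToNat q.r2)) :=
    hp.pair (ha.pair (codeFP_qhead.pair (codeFP_qtail.pair (strVal.comp codeFP_regs.2))))
  have h := codeFP_addend.comp hargs
  exact h.congr fun _ => rfl

/-- **The values of the new kinds are polynomial time.** [cite: AroraBarak2009, §1.3] [cite: VanDamSeroussi2002, §4 Algorithm 1] [cite: Kitaev1995, §3, §5] -/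
theorem codeFP_newVal : CodeFP Query.code natE newVal := by
  obtain ⟨hp, -, -, -, ht, -⟩ := codeFP_fields
  obtain ⟨hr1, hr2⟩ := codeFP_regs
  have hv1 : CodeFP Query.code natE (fun q => bitsToNat q.r1) := strVal.comp hr1
  have hv2 : CodeFP Query.code natE (fun q => bitsToNat q.r2) := strVal.comp hr2
  have hTag : ∀ k : ℕ, CodeFP Query.code bitE (fun q => decide (q.tag = k)) := fun k => (eq unE_injective).comp (ht.pair (const _ k))
  have h12 : CodeFP Query.code natE (fun q => (bitsToNat q.r2 + shL q.L q.r1) % q.p) := natMod.comp ((natAdd.comp (hv2.pair codeFP_qshL)).pair hp)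
  have h13 : CodeFP Query.code natE (fun q => (bitsToNat q.r2 + (q.p - shL q.L q.r1 % q.p)) % q.p) :=
    natMod.comp ((natAdd.comp (hv2.pair (natSub.comp (hp.pair (natMod.comp (codeFP_qshL.pair hp)))))).pair hp)
  have h14 : CodeFP Query.code natE (fun q => (bitsToNat q.r2 + shL q.L q.r1) % 2 ^ q.r2.length) :=
    natMod.comp ((natAdd.comp (hv2.pair codeFP_qshL)).pair codeFP_qQ)
  have h15 : CodeFP Query.code natE (fun q => (bitsToNat q.r2 + (2 ^ q.r2.length - shL q.L q.r1 % 2 ^ q.r2.length)) % 2 ^ q.r2.length) :=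
    natMod.comp ((natAdd.comp (hv2.pair (natSub.comp (codeFP_qQ.pair (natMod.comp (codeFP_qshL.pair codeFP_qQ)))))).pair codeFP_qQ)
  have h16 : CodeFP Query.code natE (fun q => uEstL q.L q.p q.r1) := codeFP_quEstL hp
  have h17 : CodeFP Query.code natE (fun q => kOf q.p (2 ^ q.r2.length) (uEstL q.L (2 ^ q.r2.length) q.r1)) := by
    have h := codeFP_kOf hp codeFP_qQ (codeFP_quEstL codeFP_qQ)
    exact h.congr fun _ => rfl
  have h19 : CodeFP Query.code natE (fun q => (bitsToNat q.r1 + bitsToNat q.r2) % q.p) := natMod.comp ((natAdd.comp (hv1.pair hv2)).pair hp)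
  have h20 : CodeFP Query.code natE (fun q => (bitsToNat q.r1 + (q.p - bitsToNat q.r2 % q.p)) % q.p) :=
    natMod.comp ((natAdd.comp (hv1.pair (natSub.comp (hp.pair (natMod.comp (hv2.pair hp)))))).pair hp)
  have hall := (hTag tagSHIFTP).ite h12 ((hTag tagUNSHIFTP).ite h13 ((hTag tagSHIFTQ).ite h14 ((hTag tagUNSHIFTQ).ite h15
    ((hTag tagRECONP).ite h16 ((hTag tagRECONK).ite h17 ((hTag tagADDEND).ite codeFP_qaddend ((hTag tagMODADDP).ite h19
    ((hTag tagMODSUBP).ite h20 (const _ 0)))))))))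
  refine hall.congr fun q => ?_
  rw [newVal]
  by_cases c12 : q.tag = tagSHIFTP
  · rw [decide_eq_true c12, if_pos rfl, if_pos c12]
  rw [decide_eq_false c12, if_neg Bool.false_ne_true, if_neg c12]
  by_cases c13 : q.tag = tagUNSHIFTP
  · rw [decide_eq_true c13, if_pos rfl, if_pos c13]
  rw [decide_eq_false c13, if_neg Bool.false_ne_true, if_neg c13]
  by_cases c14 : q.tag = tagSHIFTQ
  · rw [decide_eq_true c14, if_pos rfl, if_pos c14]
  rw [decide_eq_false c14, if_neg Bool.false_ne_true, if_neg c14]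
  by_cases c15 : q.tag = tagUNSHIFTQ
  · rw [decide_eq_true c15, if_pos rfl, if_pos c15]
  rw [decide_eq_false c15, if_neg Bool.false_ne_true, if_neg c15]
  by_cases c16 : q.tag = tagRECONP
  · rw [decide_eq_true c16, if_pos rfl, if_pos c16]
  rw [decide_eq_false c16, if_neg Bool.false_ne_true, if_neg c16]
  by_cases c17 : q.tag = tagRECONK
  · rw [decide_eq_true c17, if_pos rfl, if_pos c17]
  rw [decide_eq_false c17, if_neg Bool.false_ne_true, if_neg c17]
  by_cases c18 : q.tag = tagADDEND
  · rw [decide_eq_true c18, if_pos rfl, if_pos c18]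
  rw [decide_eq_false c18, if_neg Bool.false_ne_true, if_neg c18]
  by_cases c19 : q.tag = tagMODADDP
  · rw [decide_eq_true c19, if_pos rfl, if_pos c19]
  rw [decide_eq_false c19, if_neg Bool.false_ne_true, if_neg c19]
  by_cases c20 : q.tag = tagMODSUBP
  · rw [decide_eq_true c20, if_pos rfl, if_pos c20]
  rw [decide_eq_false c20, if_neg Bool.false_ne_true, if_neg c20]

/-- **The arithmetic part of the extended post-processor is polynomial time**:
`q ↦ [tag ≠ DLOG] · valOf₂ q`. [cite: AroraBarak2009, §1.3] -/
theorem codeFP_valOfP₂ : CodeFP Query.code natE (fun q => if q.tag = tagDLOG then 0 else valOf₂ q) := by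
  obtain ⟨-, -, -, -, ht, -⟩ := codeFP_fields
  have h12 : CodeFP Query.code bitE (fun q => decide (12 ≤ q.tag)) := natLeUn.comp ((const _ 12).pair ht)
  refine (h12.ite codeFP_newVal codeFP_valOfP).congr fun q => ?_
  rw [valOf₂]
  by_cases h : 12 ≤ q.tag
  · have hne : q.tag ≠ tagDLOG := by intro he; rw [he] at h; exact absurd h (by decide)
    rw [decide_eq_true h, if_pos rfl, if_neg hne, if_pos h]
  · rw [decide_eq_false h, if_neg Bool.false_ne_true, if_neg h]

end VDSOracle

end Literature.Computability.Cryptography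

end
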